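import Summits.BirchSwinnertonDyer.Rank1Residual.ManinAdditive.TowerExtension
import HarnessLib
import HarnessLib.Audit.Tags

/-!
# LEMMA MH — the finite-group rigidity behind E-an-142 `TVPatternRigidityLaw`: `MultiHubRigid q p`, the law, the edge,
# six kernel-certified instances and the assembled chain to E-an-135♭ (an g30, MEMO-an §72.10; cell `bsd-f2-manin`, T-an-35, typer g15)

HONEST FRAMING.  LENS = analytic (`bsd-f2-manin-an` g30, PROOFS-an-72.md §5 sha16 092a89d26156593c, MEMO-an-72 e6ac181028fa4c82).
SOURCE = HOME/an/g30/Sketch-an-g30.lean sha16 1beeaf8aa64c296e §7 (the three `def`s VERBATIM; §1–§6 of that sketch are byte-identical to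
43bd003eb6244594 and already landed in `TowerExtension.lean`), HOME/an/g30/g30-mh.lean a5559c3a0ecc66a4 and g30-mh2.lean fe92d91feb6139aa
(the six `decide +kernel` instances, farm rc 0 per an: g30-mh.raw.json / g30-mh2.raw.json).  Deviations: (i) this header; (ii) namespace
`…ManinAdditive.TowerExtension` (the sketch's `BsdF2ManinAnG30`), so that `TVPatternRigidityLaw`, `RigidityImpliesTower` are the TREE's;
(iii) the sketch's `instance : Decidable (MultiHubRigid q p)` is a plain `def multiHubRigidDecidable` here (no instances in statement files),
passed explicitly to `of_decide_eq_true` / `of_decide_eq_false`, the Boolean evaluation being done by `decide +kernel`; (iv) `MultiHubRigidLaw` and `MultiHubImpliesRigidity` carry `@[conjecture]`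
(obligation nodes: PROVED ON PAPER by an — PROOFS-an-72 §5 (5.4c) resp. (5.0)–(5.5) — NOT in Lean; an's L9 skeleton
HOME/an/g30/TowerRigiditySkeleton-an-g30.lean 60268fc1e4a910cb has the three stubs + a kernel-checked composition for provers p2/p3);
(v) the typer adds the PROVED assembly `someTowerUnitTwist_of_multiHub`: LEMMA MH + the edge + the tree's `RigidityImpliesTower` (E-an-143/140
chain, paper) ⟹ E-an-135♭ `KatoCurve.SomeTowerUnitTwist p` for every prime `p` (via the landed `someTowerUnitTwist_of_geFive`).

WHAT LEMMA MH SAYS (PROOFS-an-72 §5).  Rows `C = N k` of the invariance hypothesis of `TVPatternRigidity N q p` give hub periodicity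
(LEMMA A); rows `C = N qᵉ k` give the MULTI-HUB EQUATION `g(e,h) − g(e,hD) = g(e,h(1−D)/D) − g(e,h(1−D))`; by induction on the level the
profile `g(e,·)` factors through `(ℤ/q)ˣ`, where it is an EVEN `𝔽_p`-valued function satisfying that 4-term relation — and such a function is
constant iff `p ∤ (q−1)/2` (character decomposition of `𝔽̄_p[(ℤ/q)ˣ]`: characters of order `≥ 3` die by a count, the quadratic character by a
Jacobsthal count; when `p ∣ (q−1)/2` the even homomorphisms `(ℤ/q)ˣ → 𝔽_p` survive — the engine's quadratic pattern at `q = 5, 13`).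
BC5 / certificates: MH-an-g30.txt f6e398f07362fd62 (the dichotomy is exact on all 89 pairs `q ≤ 200`, `p ∈ {2,3}`); the six instances below
are decided by the kernel.  CONSEQUENCE CLAIMED BY an (paper, not Lean): with E-an-143 + E-an-140, E-an-135 `TowerUnitTwist p` at every
admissible `q ≥ 5` holds for every curve in every cell; what remains for the tree is the Lean proof of the two `@[conjecture]` rows below and of
`RigidityImpliesTower`.  REFUTER VERDICTS: R-an-54 (ref1: referee PROOFS §5) PENDING at filing.  bears_on: stmt-BirchSwinnertonDyer-22967/22968.
PARTITION (an) 0 · beyond-print theorem: not claimed · C2/C3 OPEN · BSD is not proved by this; Manin's conjecture is not proved by this.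
-/

namespace Summit.BirchSwinnertonDyer.Rank1Residual.ManinAdditive.TowerExtension

open Summit.BirchSwinnertonDyer.Rank1Residual.ManinAdditive.KatoCurve

/-! ### §7. LEMMA MH — the finite-group rigidity behind E-an-142 (PROOFS-an-72 §5; E-an-142 is PROVED on paper from it)
The multi-hub 4-term relation on `(ℤ/q)ˣ` forces an even `𝔽_p`-valued function to be constant iff `p ∤ (q−1)/2`
(else the even homomorphisms `(ℤ/q)ˣ → 𝔽_p` survive — the engine's quadratic pattern at q = 5, 13).  Kernel-certified instances
(`decide +kernel`, file g30-mh.lean / g30-mh2.lean, rc 0): `MultiHubRigid 3 2`, `7 2`, `11 2`, `5 3`; `¬ MultiHubRigid 5 2`, `¬ MultiHubRigid 7 3`.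
Table MH-an-g30.txt: the dichotomy holds for all 89 pairs (q ≤ 200, p ∈ {2,3}). -/

/-- LEMMA MH as a Prop over `ZMod q` (schema; values at `0` are irrelevant; division is the field division of `ZMod q`, `q` prime):
every even `G : ZMod q → ZMod p` satisfying the multi-hub 4-term relation `G h − G (hD) − G (h(1−D)D⁻¹) + G (h(1−D)) = 0`
(all units `h`, all units `D ≠ 1`) is constant on units. -/
def MultiHubRigid (q p : ℕ) : Prop :=
  ∀ G : ZMod q → ZMod p,
    (∀ x : ZMod q, G (-x) = G x) →
    (∀ h D : ZMod q, h ≠ 0 → D ≠ 0 → D ≠ 1 →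
        G h - G (h * D) - G (h * (1 - D) * D⁻¹) + G (h * (1 - D)) = 0) →
    ∀ x y : ZMod q, x ≠ 0 → y ≠ 0 → G x = G y

/-- **`MultiHubRigidLaw`** — LEMMA MH as a law (PROOFS-an-72 §5 (5.4c): character decomposition of `𝔽̄_p[(ℤ/q)ˣ]`, a counting
argument for characters of order ≥ 3 and a Jacobsthal count for the quadratic character).  PROVED ON PAPER by an; obligation node
until a Lean proof lands (nothing asserted). -/
@[conjecture] def MultiHubRigidLaw : Prop :=
  ∀ q p : ℕ, q.Prime → p.Prime → 3 ≤ q → q ≠ p → ¬ p ∣ (q - 1) / 2 → MultiHubRigid q p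

/-- **`MultiHubImpliesRigidity`** — the edge PROOFS-an-72 §5 (5.0–5.5): LEMMA A (hub periodicity) + deep rows + multi-hub
equation + LEMMA MH + linearity — elementary bookkeeping over `SL(2,ℤ)`; with `MultiHubRigidLaw` it yields E-an-142
`TVPatternRigidityLaw p` for every prime `p`.  PROVED ON PAPER by an (L9 skeleton with three stubs for provers:
HOME/an/g30/TowerRigiditySkeleton-an-g30.lean); obligation node until a Lean proof lands (nothing asserted). -/
@[conjecture] def MultiHubImpliesRigidity : Prop := MultiHubRigidLaw → ∀ p : ℕ, p.Prime → TVPatternRigidityLaw p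

/-- `MultiHubRigid q p` is decidable for concrete `q, p` (a finite ∀ over `ZMod q → ZMod p`); a `def`, passed explicitly where used. -/
def multiHubRigidDecidable (q p : ℕ) [NeZero q] [NeZero p] : Decidable (MultiHubRigid q p) := by
  unfold MultiHubRigid; infer_instance

/-- Kernel-certified instance, admissible pair: `q = 3, p = 2` (`(3−1)/2 = 1`). -/
theorem multiHubRigid_3_2 : MultiHubRigid 3 2 :=
  @of_decide_eq_true (MultiHubRigid 3 2) (multiHubRigidDecidable 3 2) (by decide +kernel)

/-- Kernel-certified instance, admissible pair: `q = 7, p = 2` (`7 ≡ 3 (mod 4)`). -/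
theorem multiHubRigid_7_2 : MultiHubRigid 7 2 :=
  @of_decide_eq_true (MultiHubRigid 7 2) (multiHubRigidDecidable 7 2) (by decide +kernel)

/-- Kernel-certified instance, admissible pair: `q = 11, p = 2`. -/
theorem multiHubRigid_11_2 : MultiHubRigid 11 2 :=
  @of_decide_eq_true (MultiHubRigid 11 2) (multiHubRigidDecidable 11 2) (by decide +kernel)

/-- Kernel-certified instance, admissible pair: `q = 5, p = 3` (`3 ∤ 2`). -/
theorem multiHubRigid_5_3 : MultiHubRigid 5 3 :=
  @of_decide_eq_true (MultiHubRigid 5 3) (multiHubRigidDecidable 5 3) (by decide +kernel)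

/-- Kernel-certified NON-instance, excluded pair: `q = 5, p = 2` (`5 ≡ 1 (mod 4)`): the non-square indicator is a non-constant solution. -/
theorem not_multiHubRigid_5_2 : ¬ MultiHubRigid 5 2 :=
  @of_decide_eq_false (MultiHubRigid 5 2) (multiHubRigidDecidable 5 2) (by decide +kernel)

/-- Kernel-certified NON-instance, excluded pair: `q = 7, p = 3` (`3 ∣ (7−1)/2`): the cubic-residue character is a non-constant solution. -/
theorem not_multiHubRigid_7_3 : ¬ MultiHubRigid 7 3 :=
  @of_decide_eq_false (MultiHubRigid 7 3) (multiHubRigidDecidable 7 3) (by decide +kernel)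

/-- The law's side condition is sharp at the two excluded instances: `MultiHubRigidLaw` does not speak about `(5, 2)` or `(7, 3)`
(`2 ∣ (5−1)/2`, `3 ∣ (7−1)/2`), consistently with the two certified NON-instances (sanity check, PROVED). -/
theorem multiHubRigidLaw_sideCondition_excludes : (2 ∣ (5 - 1) / 2) ∧ (3 ∣ (7 - 1) / 2) := by decide

/-- **ASSEMBLY (PROVED modulo the named rows; typer edge):** LEMMA MH (`MultiHubRigidLaw`) + the edge `MultiHubImpliesRigidity`
(⟹ E-an-142) + the tree's `RigidityImpliesTower` (E-an-142 ⟹ tower at every admissible `q ≥ 5`; E-an-143/140 chain) give the ∃q-form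
E-an-135♭ `KatoCurve.SomeTowerUnitTwist p` for every prime `p`, through the landed `someTowerUnitTwist_of_geFive` (Dirichlet). -/
theorem someTowerUnitTwist_of_multiHub (hMH : MultiHubRigidLaw) (hE : MultiHubImpliesRigidity) (hR : RigidityImpliesTower)
    {p : ℕ} (hp : p.Prime) : SomeTowerUnitTwist p :=
  someTowerUnitTwist_of_geFive (hR p hp (hE hMH p hp))

/-- The same chain one step earlier: the three rows give the `q ≥ 5` tower law `TowerUnitTwistGeFive p` for every prime `p` (PROVED edge). -/
theorem towerUnitTwistGeFive_of_multiHub (hMH : MultiHubRigidLaw) (hE : MultiHubImpliesRigidity) (hR : RigidityImpliesTower)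
    {p : ℕ} (hp : p.Prime) : TowerUnitTwistGeFive p :=
  hR p hp (hE hMH p hp)

end Summit.BirchSwinnertonDyer.Rank1Residual.ManinAdditive.TowerExtension
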